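import Literature.Probability.RandomPlanarGeometry.HexSAWStripSurfaceArchCut
import Literature.Probability.RandomPlanarGeometry.HexSAWBridges
import Literature.Probability.RandomPlanarGeometry.HexSAWLemma2
import Literature.Probability.RandomPlanarGeometry.HexSAWHammersleyWelshSix
import Literature.Probability.RandomPlanarGeometry.HexSAWBrickWallStripStrict
import Literature.Probability.RandomPlanarGeometry.HexSAWBrickWallStripDictionary
import Mathlib.Analysis.SpecialFunctions.Pow.Real
import Mathlib.Analysis.MeanInequalities
import HarnessLib

/-!
# The half-plane critical surface fugacity of honeycomb SAW, I: two-variable strip sums and the four elementary faces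
# (door (c-print) «HEX-YC-PRINT» of the lane «pcv-sawmu», tree edition file T1 of 3)

Topic `Literature/Probability/RandomPlanarGeometry` (continues `HexSAWStripSurfaceArchCut.lean` — the surface-weighted
class sums `HV.surfContacts`, `HV.stripGFy` of the Duminil-Copin–Smirnov strips `S_{T,L}` = `HV.stripV T L` at `x = x_c` —
and `HexSAWBridges.lean` / `HexSAWLowerBound.lean` — `HV.bridgeLists`, `HV.flip`, `HV.shift`, the Hammersley–Welsh cuts).
Sources: N. R. Beaton, M. Bousquet-Mélou, J. de Gier, H. Duminil-Copin, A. J. Guttmann, *The critical fugacity for surface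
adsorption of self-avoiding walks on the honeycomb lattice is `1 + √2`*, Comm. Math. Phys. 326 (2014) 727–754
(arXiv:1109.0358v5; «BBdGDCG14»): §3.1 (half-plane partition functions `C^+`, Prop. 5 = the definition of `y_c`,
arXiv v5 p. 9), §3.2 (the strip partition functions `A_T(x,y)`, `B_T(x,y)`, Prop. 6–7, Cor. 8, pp. 10–12), Theorem 2
(`y_c = 1 + √2`, p. 3); H. Duminil-Copin, S. Smirnov, Ann. of Math. 175 (2012) §3; J. M. Hammersley, G. M. Torrie,
S. G. Whittington, J. Phys. A 15 (1982) 539 (log-convexity of the surface free energy).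
PAGE LOCATORS are arXiv v5's; quoted wording is the held LaTeX (= arXiv v1 (2011)) per the lane's concordance rule.

DESIGN AND AUTHORSHIP.  Statements and proofs are a-idea-1 gen 18's HOME sketch `Sketch_G18_YcPrint.lean` ed.3
(sha16 afa93605411295e6; code-identical in ed.5 08b0d94aa61eee15, 2026-08-23) VERBATIM, moved to the tree namespace `…SAW.HV` by the filer a-p6 gen 8; the top-contact
count is the tree's `HV.surfContacts` (same defining text as the sketch's `topContacts`), and at `x = x_c` the two-variable
class sum below IS the tree's `HV.stripGFy` (`stripGFxy_xc`, by `rfl`).  The door replaces BBdGDCG14's passage strip ↔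
half-plane (Props 6–8: unfolding, prime arches, strip convergence) by two elementary transfers with explicit rates; this file
carries the vocabulary and the four faces that are elementary on the tree: D2 `LevelCost` (`B_{T,L}(x;y) ≤ (x/x_c)^{2T}
B_{T,L}(x_c;y)`), D4 `HoelderXY` (joint log-convexity of the finite sums), `TailCount`, D6 `ReversalInjection`
(`B_{T,L}(x;y) ≤ C^+_{T,2L+T}(x,y)` by reversing bridges under the level flip), D5 `StripSupercritFinite` (one supercritical
finite point of every strip, from the tree's `HexBW.stripConnectiveConstant_lt_hex`).  Files T2 (`HexSAWSurfaceYcCut.lean`: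
D1, the two-cut decomposition of half-plane walks) and T3 (`HexSAWSurfaceYc.lean`: the Hölder transfer, the desorbed bound
and `hexSurfaceYc = 1 + √2`) continue.

READING AS PRINTED (four sentences of record, lit-1 g12 pre-audit 2026-08-23 07:17Z; to be carried by the tree edition's headers):
(i) WHICH `y_c`: `hexSurfaceYc` = `sup {y ≥ 0 : limsup_n C_n⁺(y)^{1/n} ≤ μ}` unconditionally (nonnegative terms, the boxes `S_{T,L}`
exhaust `{lev ≥ 0}`, root test); it IS the `y_c` of BBdGDCG14 Prop. 5 granted Prop. 5's existence clause (Hammersley–Torrie–Whittington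
1982, cited there as [15]; not formalised — optional face `HalfPlaneGrowthExists`); the theorem `hexSurfaceYc = 1 + √2` is Theorem 2
(arXiv v5 p. 3) in radius form.  (ii) Cor. 8 (v5 p. 12: "`A_T(x,y)`, `B_T(x,y)` and `C_T(x,y)` all have the same radius of convergence
`ρ_T(y) = 1/μ_{T−1}(1,y)` … There exists a unique `y_T > 0` such that `ρ_T(y_T) = x_c` … `y_T` decreases to the critical fugacity `y_c`")
is NOT used and NOT formalised here: the door never passes through `y_T`; `StripBetaBoundXc` / `StripBetaUnboundedXc` are the strip
identities' consequences at `x = x_c` (lane T-A′ / T-B′), not Cor. 8.  (iii) CONVENTIONS: print counts `n`-step walks from the mid-edge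
`a` just below the surface with `i` "monomers in the surface" (§3.1, v5 p. 9: `C_n^+(y) = Σ_{i=0}^n c_n^+(i) y^i`); `hpGF` sums the
mid-edge walks of the box `S_{T,L}` with `x^{mwLen} · y^{botContacts}` (inner level-0 vertices) — the normalisation differs from print
by bounded factors and fixed shifts (≤ 2 final half-edges, the length offset, whether the first surface vertex is counted), so `y_c`
and all radii are invariant.  (iv) LABEL: statement = FORMALISATION of a printed, proved theorem (BBdGDCG14 Theorem 2) ⇒
CONSOLIDATION-grade; PROOF ARCHITECTURE: desorbed half = Glazman–Manolescu 2020 §5.4's two-cut route (last surface visit / deepest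
visit, explicit level-cost rate), formalised with explicit constants; adsorbed half = NEW (Hölder log-convexity transfer from one
supercritical strip point + reversal injection + the strip-level divergence T-B′, replacing BBdGDCG14 Props 6–8 / Cor. 8 and GM20
§5.1–5.3's import of Cor. 8); the "why novel" sentence is the adsorbed-half architecture, not the number.  [(iv) as amended by
lit-1 g12 07:30Z after the GM20 prior-art finding; (i)–(iii) and the dictionary below are a-idea-1 ed.5 ll. 55–71 verbatim.]
STRIP-INDEX DICTIONARY: the lane's `S_T = HV.stripV T L` has the `2T` vertex levels `0,…,2T−1` (= DCS's strip of width `T` in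
their indexing), whence the exponent `2T` in `LevelCost` against DCS's printed `(x/x_c)^T`.

NEAREST PRIOR ART (lit-1 g12 2026-08-23 07:24Z, folded by the filer): A. Glazman, I. Manolescu, *Self-avoiding walk on `ℤ²` with
Yang–Baxter weights: universality of critical fugacity and 2-point function*, AIHP 56 (2020), arXiv:1708.00395v3, §5: Definition 1.1
(v3 p. 5, eq. (5): `y_c(Θ) = sup{y ≥ 0 | ∀ 0 < x < 1, SAW_Θ(x,y) < ∞}`, "exactly the definition of critical fugacity used in
[BBMDG+14]") IS this file's sup-radius `hexSurfaceYc` at `Θ ≡ π/3`; §5.4 (pp. 23–24) proves the desorbed half by the same two-cut route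
(last visit of column 1; two bridges of one strip × a free walk; "cross at least `T` rhombi ⇒ `x^T`") with the strip input Cor. 2.5
(p. 9) = the lane's K97.1 bound.  DELTA of the door: the supercritical half WITHOUT BBdGDCG14 Corollary 8 (GM20 §5.1–5.3 import it) —
Hölder transfer from one supercritical strip point + reversal injection + the strip-level divergence — with explicit constants,
kernel-checked.  Label of record (lit-1): CONSOLIDATION (printed, proved theorem; new Cor.-8-free route for the adsorbed half).
-/

noncomputable section

open Finset Filter Topology

namespace Literature.Probability.RandomPlanarGeometry.SAW.HV

/-! ### Vocabulary: two-variable class sums of `S_{T,L}` and the truncated half-plane partition function -/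

/-- Surface contacts of a half-plane walk from `a`: inner vertices on level `0` (the surface row the walk starts in).
[cite: BeatonBousquetMelouDeGierDuminilCopinGuttmann2014, §3.1 (arXiv v5 pp. 8–9: `c_n^+(i)`, `i` monomers in the surface; v1 wording)] -/
def botContacts (P : List HV) : ℕ := ((inner P).filter fun v => lev v = 0).length

/-- Two-variable class partition function of `S_{T,L}`: `Σ_{γ : finalDart ∈ cls} x^{ℓ(γ)} y^{c(γ)}`; at `x = x_c` it is Y2′'s
`HV.stripGFy T L cls y`. [cite: BeatonBousquetMelouDeGierDuminilCopinGuttmann2014, §3.2 (arXiv v5 p. 11: `A_T(x,y)`, `B_T(x,y)`, `C_T(x,y)`)] -/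
def stripGFxy (T L : ℕ) (cls : HV × HV → Prop) [DecidablePred cls] (x y : ℝ) : ℝ :=
  ∑ P ∈ (midWalks (stripV T L)).filter (fun P => cls (finalDart P)), x ^ mwLen P * y ^ surfContacts T P

/-- Half-plane two-variable partition function, truncated to the box `S_{T,L}` (all exit classes):
`Σ_{γ ⊂ S_{T,L} from a} x^{ℓ(γ)} y^{#level-0 vertices}`; the half-plane `{lev ≥ 0}` is exhausted by the boxes.  (Mid-edge walks:
each vertex-terminated `n`-step walk of print has exactly two final half-edges, a factor `2` irrelevant to radii.)
[cite: BeatonBousquetMelouDeGierDuminilCopinGuttmann2014, §3.1 (arXiv v5 pp. 8–9: `C_n^+(y) = Σ_i c_n^+(i) y^i`; v1 wording)] -/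
def hpGF (T L : ℕ) (x y : ℝ) : ℝ := ∑ P ∈ midWalks (stripV T L), x ^ mwLen P * y ^ botContacts P

/-- "`C^+(x, y) < ∞`": the box truncations are bounded. [cite: BeatonBousquetMelouDeGierDuminilCopinGuttmann2014, §3.2, Cor. 8 (`ρ_T(y)` decreases to `ρ(y) := 1/μ(y)`, arXiv v5 p. 12; v1 wording); GlazmanManolescu2019, Definition 1.1 (arXiv v3 p. 5, eq. (5): `SAW_Θ(x,y) < ∞`)] -/
def HalfPlaneBounded (x y : ℝ) : Prop := BddAbove (Set.range fun p : ℕ × ℕ => hpGF p.1 p.2 x y)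

/-- The desorbed set `{y ≥ 0 | ρ(y) ≥ x_c}` = `{y | μ(y) ≤ μ}` of Prop. 5 (its displayed, unnumbered dichotomy `μ(y) = μ` iff `y ≤ y_c`). [cite: BeatonBousquetMelouDeGierDuminilCopinGuttmann2014, Prop. 5 (arXiv v5 p. 9); GlazmanManolescu2019, Definition 1.1 (arXiv v3 p. 5, eq. (5))] -/
def ycSet : Set ℝ := {y | 0 ≤ y ∧ ∀ x : ℝ, 0 < x → x < hexCriticalFugacity → HalfPlaneBounded x y}

/-- **The half-plane critical surface fugacity** `y_c := sup {y : μ(y) = μ}` (Prop. 5), in radius form: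
`hexSurfaceYc = sup {y ≥ 0 : limsup_n C_n⁺(y)^{1/n} ≤ μ}` (root test on the box-exhausted half-plane sum, nonnegative terms); it
equals the `y_c` of BBdGDCG14 Prop. 5 granted Prop. 5's existence clause (Hammersley–Torrie–Whittington 1982, [15] there; not
formalised), and it is Glazman–Manolescu's Definition 1.1 at `Θ ≡ π/3` ("exactly the definition of critical fugacity used in
[BBMDG+14]"); Theorem 2 (v5 p. 3), `hexSurfaceYc = 1 + √2`, is proved in `HexSAWSurfaceYc.lean`.
[cite: BeatonBousquetMelouDeGierDuminilCopinGuttmann2014, Prop. 5 (arXiv v5 p. 9) and Theorem 2 (p. 3); GlazmanManolescu2019, Definition 1.1 (arXiv v3 p. 5, eq. (5)) and the paragraph after Theorem 3 (p. 5); HammersleyTorrieWhittington1982] -/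
def hexSurfaceYc : ℝ := sSup ycSet

/-- At `x = x_c` the two-variable class sum IS the tree's surface-weighted class sum `HV.stripGFy` of
`HexSAWStripSurfaceArchCut.lean` (same defining text). [cite: BeatonBousquetMelouDeGierDuminilCopinGuttmann2014, §3.2 (arXiv v5 p. 11)] -/
theorem stripGFxy_xc (T L : ℕ) (cls : HV × HV → Prop) [DecidablePred cls] (y : ℝ) :
    stripGFxy T L cls hexCriticalFugacity y = stripGFy T L cls y := rfl

/-- At `x = x_c`, `y = 1` the `β`-class sum is DCS's `B_{T,L}(x_c)`. [cite: DuminilCopinSmirnov2012, §3 (B_{T,L})] -/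
theorem stripGFxy_beta_xc_one (T L : ℕ) : stripGFxy T L (IsBetaDart T) hexCriticalFugacity 1 = stripB T L hexCriticalFugacity := by
  rw [stripGFxy_xc, stripGFy_beta_one]

/-! ### The faces of this file (each proved below) -/

/-- **D2 «LEVEL-COST» (explicit locality rate).**  A walk from `a` to `β` in `S_T` visits every level `0,…,2T−1`, so `ℓ ≥ 2T` and
`B_{T,L}(x; y) ≤ (x/x_c)^{2T} B_{T,L}(x_c; y)` for `0 ≤ x ≤ x_c` (the lane's `S_T` has the `2T` levels `0,…,2T−1` = DCS's width `T`, whence `2T` against the printed `(x/x_c)^T`). [cite: DuminilCopinSmirnov2012, §3 (every edge joins consecutive levels; bridges of `S_T` have length ≥ T — proof of Theorem 1, `B_T^x ≤ (x/x_c)^T B_T^{x_c}`); GlazmanManolescu2019, §5.4, proof of Theorem 3 (arXiv v3 p. 24: "all walks which contribute to B_{T,Θ}(1,y) have to cross at least T rhombi. Thus, B_{T,Θ}(x,y) < x^T·c")] -/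
def LevelCost : Prop := ∀ (T L : ℕ) (x y : ℝ), 0 ≤ x → x ≤ hexCriticalFugacity → 0 ≤ y →
  stripGFxy T L (IsBetaDart T) x y ≤ (x / hexCriticalFugacity) ^ (2 * T) * stripGFxy T L (IsBetaDart T) hexCriticalFugacity y

/-- **Tail counts**: SAW counts from any vertex of the coordinate model equal the tree's `hexSawCount` (isomorphism
`hexGraph ≃g hvGraph` + the point reflection exchanging the two vertex classes). [cite: DuminilCopinSmirnov2012, §1 (`c_n` independent of the starting vertex)] -/
def TailCount : Prop := ∀ (v : HV) (m : ℕ), (sawCount hvGraph v m : ℝ) ≤ hexSawCount m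

/-- **D4 «HÖLDER»**: the finite sums `B_{T,L}(x; y) = Σ x^ℓ y^c` are jointly log-convex in `(log x, log y)`:
`B(x₁^{1−θ} x₂^θ; y₁^{1−θ} y₂^θ) ≤ B(x₁; y₁)^{1−θ} B(x₂; y₂)^θ`. (HTW82 "κ is log-convex", finite form; the `ℤ^d` one-variable
twin is a-p3's `Zd.adsZ_rpow_mul_rpow_le`.)  The adsorbed half of the door (D4–D7) does NOT follow Glazman–Manolescu §5.1–5.3, which import BBdGDCG14 Cor. 8. [cite: BeatonBousquetMelouDeGierDuminilCopinGuttmann2014, Prop. 5 ("log-convex, non-decreasing function of log y", arXiv v5 p. 9; proof "by Hammersley, Torrie and Whittington [HTW82] … mutatis mutandis") and Prop. 6 ("μ_T(1,y) is log-convex", p. 10); HammersleyTorrieWhittington1982] -/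
def HoelderXY : Prop := ∀ (T L : ℕ) (x₁ x₂ y₁ y₂ θ : ℝ), 0 < x₁ → 0 < x₂ → 0 < y₁ → 0 < y₂ → 0 < θ → θ < 1 →
  stripGFxy T L (IsBetaDart T) (x₁ ^ (1 - θ) * x₂ ^ θ) (y₁ ^ (1 - θ) * y₂ ^ θ)
    ≤ stripGFxy T L (IsBetaDart T) x₁ y₁ ^ (1 - θ) * stripGFxy T L (IsBetaDart T) x₂ y₂ ^ θ

/-- **D5 «STRIP-SUPERCRITICAL-FINITE»** (= HEX-STRIP-STRICT in generating-function form): for each `T ≥ 1` some `x₁ > x_c` still has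
`L ↦ B_{T,L}(x₁; 1)` bounded (`μ(S_T) < μ_ℍ`: tree `HexBW.stripConnectiveConstant_lt_hex` for the row strip with `2T` levels =
DCS `S_T` by `HexSAWBrickWallStripDictionary`, + `HexBW.tendsto_stripCount_rpow`). [cite: BeatonBousquetMelouDeGierDuminilCopinGuttmann2014, Prop. 7 at y = 1 ("μ_T < μ_{T+1}", arXiv v5 p. 11); MadrasSlade1993, Theorem 8.2.1 / eq. (8.2.11)] -/
def StripSupercritFinite : Prop := ∀ T : ℕ, 1 ≤ T → ∃ x₁ : ℝ, hexCriticalFugacity < x₁ ∧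
  BddAbove (Set.range fun L : ℕ => stripGFxy T L (IsBetaDart T) x₁ 1)

/-- **D6 «REVERSAL INJECTION»**: the point reflection `HV.shift _ T ∘ HV.flip` (`lev ↦ 2T−1−lev` by `lev_flip`, `lev_shift`; a graph
automorphism for every `T`) ∘ reversal ∘ horizontal translation maps the `β`-walks of `S_{T,L}` injectively (`L' = 2L + 2T + 2`) to
half-plane walks from `a` inside some box `S_{T,L'}`, with `ℓ` preserved and top contacts ↦ level-0 contacts; hence
`B_{T,L}(x; y) ≤ C^+_{T,L'}(x, y)`. [cite: BeatonBousquetMelouDeGierDuminilCopinGuttmann2014, Prop. 6 ("by the symmetry of bridges, μ_T(y,z) = μ_T(z,y)", arXiv v5 p. 10) and §3.1 (strip ⊂ half-plane)] -/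
def ReversalInjection : Prop := ∀ (T L : ℕ) (x y : ℝ), 1 ≤ T → 0 ≤ x → 0 ≤ y →
  ∃ L' : ℕ, stripGFxy T L (IsBetaDart T) x y ≤ hpGF T L' x y

/-! ### Elementary facts used by the glue -/

/-- The class sums are nonnegative for `x, y ≥ 0` (nonnegative coefficients). [cite: BeatonBousquetMelouDeGierDuminilCopinGuttmann2014, §3.2, above Corollary 8 (arXiv v5 p. 12: "the analogous series A_T(x;y) and B_T(x;y) that count arches and bridges")] -/
theorem stripGFxy_nonneg (T L : ℕ) (cls : HV × HV → Prop) [DecidablePred cls] {x y : ℝ} (hx : 0 ≤ x) (hy : 0 ≤ y) :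
    0 ≤ stripGFxy T L cls x y :=
  sum_nonneg fun _ _ => mul_nonneg (pow_nonneg hx _) (pow_nonneg hy _)

/-- The truncated half-plane partition function is nonnegative for `x, y ≥ 0` (nonnegative coefficients). [cite: BeatonBousquetMelouDeGierDuminilCopinGuttmann2014, §3.1 (arXiv v5 pp. 8–9: C⁺_k(y), the half-plane partition function)] -/
theorem hpGF_nonneg (T L : ℕ) {x y : ℝ} (hx : 0 ≤ x) (hy : 0 ≤ y) : 0 ≤ hpGF T L x y :=
  sum_nonneg fun _ _ => mul_nonneg (pow_nonneg hx _) (pow_nonneg hy _)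

/-- Monotonicity of the class sums in both variables (termwise; nonnegative coefficients). [cite: BeatonBousquetMelouDeGierDuminilCopinGuttmann2014, §3.2, above Corollary 8 (arXiv v5 p. 12: "the analogous series A_T(x;y) and B_T(x;y) that count arches and bridges")] -/
theorem stripGFxy_mono (T L : ℕ) (cls : HV × HV → Prop) [DecidablePred cls] {x x' y y' : ℝ}
    (hx : 0 ≤ x) (hxx' : x ≤ x') (hy : 0 ≤ y) (hyy' : y ≤ y') :
    stripGFxy T L cls x y ≤ stripGFxy T L cls x' y' :=
  sum_le_sum fun _ _ => mul_le_mul (pow_le_pow_left₀ hx hxx' _) (pow_le_pow_left₀ hy hyy' _)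
    (pow_nonneg hy _) (pow_nonneg (hx.trans hxx') _)

/-! ### PROVED FACES: D2 «LEVEL-COST» and D4 «HÖLDER» -/

/-- A walk `a → β` of `S_T` has at least `2T` inner vertices (levels `0 → 2T−1`, one level per step).
[cite: DuminilCopinSmirnov2012, §3 ("a bridge of width T has length at least T")] -/
theorem two_mul_le_mwLen_of_isBetaDart {T L : ℕ} (hT : 1 ≤ T) {P : List HV} (hP : IsMidWalk (stripV T L) P)
    (hβ : IsBetaDart T (finalDart P)) : 2 * T ≤ mwLen P := by
  have hl : inner P ∈ bridgeLists T L :=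
    mem_image_of_mem _ (mem_filter.2 ⟨mem_midWalks_iff.2 hP, hβ⟩)
  obtain ⟨hc, hh, -, -, hne, hlev⟩ := (mem_bridgeLists_iff hT).1 hl
  have hlen : 2 * T ≤ (inner P).length := by
    have hpos : 0 < (inner P).length := List.length_pos_iff.2 hne
    have h1 := lev_getElem_sub_le hc (Nat.zero_le _) (Nat.sub_one_lt_of_lt hpos)
    rw [← List.getLast_eq_getElem hne, hlev] at h1
    have h0 : (inner P)[0] = hvOrigin := by
      rw [List.head?_eq_getElem?, List.getElem?_eq_getElem hpos, Option.some_inj] at hh; exact hh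
    rw [h0, lev_hvOrigin] at h1
    push_cast at h1
    omega
  rwa [hP.length_inner] at hlen

/-- **D2 holds** (termwise: `x^ℓ = (x/x_c)^ℓ x_c^ℓ ≤ (x/x_c)^{2T} x_c^ℓ`). [cite: DuminilCopinSmirnov2012, §3 ("B_T^x ≤ (x/x_c)^T B_T^{x_c}")] -/
theorem levelCost_holds : LevelCost := by
  intro T L x y hx hxc hy
  have hxc0 : 0 < hexCriticalFugacity := hexCriticalFugacity_pos_lt_one.1
  rcases Nat.eq_zero_or_pos T with rfl | hT
  · simpa using stripGFxy_mono 0 L (IsBetaDart 0) hx hxc hy le_rfl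
  unfold stripGFxy
  rw [mul_sum]
  refine sum_le_sum fun P hP => ?_
  obtain ⟨hPm, hβ⟩ := mem_filter.1 hP
  have hlen := two_mul_le_mwLen_of_isBetaDart hT (mem_midWalks_iff.1 hPm) hβ
  have hρ0 : 0 ≤ x / hexCriticalFugacity := div_nonneg hx hxc0.le
  have hρ1 : x / hexCriticalFugacity ≤ 1 := (div_le_one hxc0).2 hxc
  have hxl : x ^ mwLen P = (x / hexCriticalFugacity) ^ mwLen P * hexCriticalFugacity ^ mwLen P := by
    rw [← mul_pow, div_mul_cancel₀ _ hxc0.ne']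
  rw [hxl, mul_assoc]
  exact mul_le_mul_of_nonneg_right (pow_le_pow_of_le_one hρ0 hρ1 hlen)
    (mul_nonneg (pow_nonneg hxc0.le _) (pow_nonneg hy _))

/-- **D4 holds**: Hölder with exponents `1/(1−θ)`, `1/θ` on the finite sum, after splitting each monomial
`(x₁^{1−θ}x₂^θ)^ℓ (y₁^{1−θ}y₂^θ)^c = (x₁^ℓ y₁^c)^{1−θ} (x₂^ℓ y₂^c)^θ` (the two-variable twin of a-p3's `Zd.adsZ_rpow_mul_rpow_le`).
[cite: BeatonBousquetMelouDeGierDuminilCopinGuttmann2014, Prop. 5 (arXiv v5 p. 9) and Prop. 6 (p. 10); HammersleyTorrieWhittington1982] -/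
theorem hoelderXY_holds : HoelderXY := by
  intro T L x₁ x₂ y₁ y₂ θ hx₁ hx₂ hy₁ hy₂ hθ0 hθ1
  have h1θ : 0 < 1 - θ := by linarith
  have hpq : (1 / (1 - θ)).HolderConjugate (1 / θ) := Real.holderConjugate_one_div h1θ hθ0 (by ring)
  have hcomm : ∀ {a : ℝ}, 0 ≤ a → ∀ (r : ℝ) (n : ℕ), (a ^ r) ^ n = (a ^ n) ^ r := fun ha r n => by
    rw [← Real.rpow_mul_natCast ha, mul_comm r (n : ℝ), Real.rpow_natCast_mul ha]
  have hsplit : ∀ P : List HV,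
      (x₁ ^ (1 - θ) * x₂ ^ θ) ^ mwLen P * (y₁ ^ (1 - θ) * y₂ ^ θ) ^ surfContacts T P =
        (x₁ ^ mwLen P * y₁ ^ surfContacts T P) ^ (1 - θ) * (x₂ ^ mwLen P * y₂ ^ surfContacts T P) ^ θ := by
    intro P
    rw [mul_pow, mul_pow, hcomm hx₁.le, hcomm hx₂.le, hcomm hy₁.le, hcomm hy₂.le,
      Real.mul_rpow (pow_nonneg hx₁.le _) (pow_nonneg hy₁.le _),
      Real.mul_rpow (pow_nonneg hx₂.le _) (pow_nonneg hy₂.le _)]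
    ring
  unfold stripGFxy
  simp_rw [hsplit]
  set s := (midWalks (stripV T L)).filter (fun P => IsBetaDart T (finalDart P)) with hs_def
  have hH := Real.inner_le_Lp_mul_Lq_of_nonneg s hpq
    (f := fun P => (x₁ ^ mwLen P * y₁ ^ surfContacts T P) ^ (1 - θ))
    (g := fun P => (x₂ ^ mwLen P * y₂ ^ surfContacts T P) ^ θ)
    (fun P _ => Real.rpow_nonneg (mul_nonneg (pow_nonneg hx₁.le _) (pow_nonneg hy₁.le _)) _)
    (fun P _ => Real.rpow_nonneg (mul_nonneg (pow_nonneg hx₂.le _) (pow_nonneg hy₂.le _)) _)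
  have hf : ∀ P : List HV, ((x₁ ^ mwLen P * y₁ ^ surfContacts T P) ^ (1 - θ)) ^ (1 / (1 - θ)) =
      x₁ ^ mwLen P * y₁ ^ surfContacts T P := fun P => by
    rw [← Real.rpow_mul (mul_nonneg (pow_nonneg hx₁.le _) (pow_nonneg hy₁.le _)), mul_one_div_cancel h1θ.ne',
      Real.rpow_one]
  have hg : ∀ P : List HV, ((x₂ ^ mwLen P * y₂ ^ surfContacts T P) ^ θ) ^ (1 / θ) =
      x₂ ^ mwLen P * y₂ ^ surfContacts T P := fun P => by
    rw [← Real.rpow_mul (mul_nonneg (pow_nonneg hx₂.le _) (pow_nonneg hy₂.le _)), mul_one_div_cancel hθ0.ne',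
      Real.rpow_one]
  simp only [hf, hg, one_div_one_div] at hH
  exact hH

/-- **`TailCount` holds** — vertex-transitivity of `ℍ` in the HV frame is already in the tree (`HV.card_sawFin_eq`).
(tree `HexSAWLattice.card_sawFin_eq`). [cite: DuminilCopinSmirnov2012, §1 (c_n, the number of n-step self-avoiding walks, does not depend on the starting point)] -/
theorem tailCount_holds : TailCount := by
  intro v m
  have h : sawCount hvGraph v m = hexSawCount m := by
    rw [sawCount_eq_ncard_sawLists, ncard_sawLists_eq_card_sawFin, card_sawFin_eq, hexSawCount_eq_card]
  rw [h]

/-! ### D6 PROVED: the reversal injection `B_{T,L}(x; y) ≤ C^+_{T,2L+T}(x, y)` -/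

section Reversal

variable {T L : ℕ}

/-- The point reflection `σ_{T,a} := shift a T ∘ flip : (p, q, c) ↦ (a − p, T − 1 − q, ¬c)` — a graph automorphism of `ℍ` with
`lev ∘ σ_{T,a} = 2T − 1 − lev` for EVERY `T` (it exchanges the bottom and top levels of `S_T`).
[cite: BeatonBousquetMelouDeGierDuminilCopinGuttmann2014, Prop. 6 ("by the symmetry of bridges", arXiv v5 p. 10)] -/
def sigmaT (T : ℕ) (a : ℤ) : hvGraph ≃g hvGraph := flip.trans (shift a T)

/-- `σ_{T,a}` in coordinates. [cite: BeatonBousquetMelouDeGierDuminilCopinGuttmann2014, Prop. 6 ("by the symmetry of bridges", arXiv v5 p. 10)] -/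
@[simp] theorem sigmaT_apply (T : ℕ) (a : ℤ) (v : HV) : sigmaT T a v = (-v.1 + a, -v.2.1 - 1 + T, !v.2.2) := rfl

/-- `σ_{T,a}` reverses the levels of `S_T`. [cite: BeatonBousquetMelouDeGierDuminilCopinGuttmann2014, Prop. 6 (arXiv v5 p. 10)] -/
@[simp] theorem lev_sigmaT (T : ℕ) (a : ℤ) (v : HV) : lev (sigmaT T a v) = 2 * (T : ℤ) - 1 - lev v := by
  obtain ⟨p, q, c⟩ := v; cases c <;> simp [lev, bit] <;> ring

/-- The horizontal coordinate of the last vertex of a list (junk `0` for `[]`). [folklore] -/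
def lastX (l : List HV) : ℤ := (l.getLast?.getD hvOrigin).1

/-- **The reversal map**: reverse the bridge and apply `σ_{T,a}` with `a` = the abscissa of its endpoint, so that the image starts at `O`.
[cite: BeatonBousquetMelouDeGierDuminilCopinGuttmann2014, Prop. 6 (symmetry of bridges, arXiv v5 p. 10)] -/
def revBr (T : ℕ) (l : List HV) : List HV := l.reverse.map (sigmaT T (lastX l))

/-- The reversal preserves the number of vertices. [cite: BeatonBousquetMelouDeGierDuminilCopinGuttmann2014, Prop. 6 ("by the symmetry of bridges", arXiv v5 p. 10)] -/
@[simp] theorem length_revBr (T : ℕ) (l : List HV) : (revBr T l).length = l.length := by simp [revBr]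

/-- The reversal turns top-level vertices into level-`0` vertices, bijectively. [cite: BeatonBousquetMelouDeGierDuminilCopinGuttmann2014, Prop. 6 (arXiv v5 p. 10)] -/
theorem filter_revBr (T : ℕ) (l : List HV) :
    ((revBr T l).filter fun v => lev v = 0).length = (l.filter fun v => lev v = 2 * (T : ℤ) - 1).length := by
  rw [revBr, List.filter_map, List.length_map, List.filter_reverse, List.length_reverse]
  congr 1
  refine List.filter_congr fun v _ => ?_
  simp only [Function.comp_apply, lev_sigmaT, decide_eq_decide]
  omega

/-- Anatomy of the endpoint of a bridge of `S_{T,L}`: it is `(a, T − 1, 1)` with `−L − T ≤ a ≤ L`. [cite: DuminilCopinSmirnov2012, §3 (β)] -/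
theorem getLast_of_mem_bridgeLists (hT : 1 ≤ T) {l : List HV} (hl : l ∈ bridgeLists T L) :
    ∃ h : l ≠ [], l.getLast h = (lastX l, (T : ℤ) - 1, true) ∧ -(L : ℤ) - T ≤ lastX l ∧ lastX l ≤ L := by
  rw [mem_bridgeLists_iff hT] at hl
  obtain ⟨-, -, -, hV, hne, hlev⟩ := hl
  have hX : lastX l = (l.getLast hne).1 := by
    rw [lastX, List.getLast?_eq_some_getLast hne, Option.getD_some]
  have hw := hV _ (List.getLast_mem hne)
  refine ⟨hne, ?_⟩
  rw [hX]
  revert hlev hw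
  generalize l.getLast hne = w
  intro hlev hw
  rw [mem_stripV_iff] at hw
  obtain ⟨p, q, c⟩ := w
  cases c <;> simp [lev, bit] at hlev hw ⊢ <;> omega

/-- A bridge is `O :: Q`. [cite: DuminilCopinSmirnov2012, §3] -/
theorem exists_eq_cons_of_mem_bridgeLists (hT : 1 ≤ T) {l : List HV} (hl : l ∈ bridgeLists T L) :
    ∃ Q : List HV, l = hvOrigin :: Q := by
  rw [mem_bridgeLists_iff hT] at hl
  obtain ⟨-, hh, -, -, hne, -⟩ := hl
  match l, hh with
  | v :: Q, hh => simp only [List.head?_cons, Option.some.injEq] at hh; exact ⟨Q, by rw [hh]⟩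

/-- The last vertex of the reversed bridge is `σ_{T, lastX l}(O) = (lastX l, T − 1, 1)`. [cite: BeatonBousquetMelouDeGierDuminilCopinGuttmann2014, Prop. 6 ("by the symmetry of bridges", arXiv v5 p. 10)] -/
theorem getLast?_revBr (hT : 1 ≤ T) {l : List HV} (hl : l ∈ bridgeLists T L) :
    (revBr T l).getLast? = some (lastX l, (T : ℤ) - 1, true) := by
  obtain ⟨Q, rfl⟩ := exists_eq_cons_of_mem_bridgeLists hT hl
  rw [revBr, List.reverse_cons, List.map_append, List.map_singleton, List.getLast?_append, List.getLast?_singleton]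
  simp [hvOrigin]
  omega

/-- **The reversed bridge is a bridge of `S_{T,2L+T}`** (chain: `σ` is an automorphism; starts at `σ(endpoint) = O`; self-avoiding;
inside the wider box; ends at `σ(O)` on the top level). [cite: BeatonBousquetMelouDeGierDuminilCopinGuttmann2014, Prop. 6 (arXiv v5 p. 10)] -/
theorem revBr_mem (hT : 1 ≤ T) {l : List HV} (hl : l ∈ bridgeLists T L) : revBr T l ∈ bridgeLists T (2 * L + T) := by
  obtain ⟨hne, hw, ha1, ha2⟩ := getLast_of_mem_bridgeLists hT hl
  have hlast := getLast?_revBr hT hl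
  rw [mem_bridgeLists_iff hT] at hl ⊢
  obtain ⟨hc, hh, hnd, hV, -, -⟩ := hl
  have hr : revBr T l ≠ [] := by simpa [revBr] using hne
  refine ⟨?_, ?_, ?_, ?_, hr, ?_⟩
  · -- chain
    rw [revBr, List.isChain_map, List.isChain_reverse]
    exact hc.imp fun u v (h : hvGraph.Adj u v) => ((sigmaT T (lastX l)).map_rel_iff.2 h).symm
  · -- head = σ (endpoint) = O
    rw [revBr, List.head?_map, List.head?_reverse, List.getLast?_eq_some_getLast hne, hw, Option.map_some, sigmaT_apply]
    simp [hvOrigin]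
  · -- nodup
    exact (List.nodup_reverse.2 hnd).map (sigmaT T (lastX l)).injective
  · -- inside S_{T, 2L+T}
    intro v hv
    rw [revBr, List.mem_map] at hv
    obtain ⟨u, hu, rfl⟩ := hv
    rw [List.mem_reverse] at hu
    have := hV u hu
    rw [mem_stripV_iff] at this ⊢
    obtain ⟨p, q, c⟩ := u
    cases c <;> simp [lev, bit] at this ⊢ <;> omega
  · -- the last vertex σ(O) = (lastX l, T − 1, 1) lies on the top level
    rw [List.getLast?_eq_some_getLast hr, Option.some_inj] at hlast
    rw [hlast, lev_mk, bit_true]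
    ring

/-- **The reversal map is injective on the bridges of `S_{T,L}`** (the endpoint abscissa is read off the image's last vertex, then
`σ` is an involution-free bijection on lists). [cite: BeatonBousquetMelouDeGierDuminilCopinGuttmann2014, Prop. 6 (arXiv v5 p. 10)] -/
theorem revBr_injOn (hT : 1 ≤ T) : Set.InjOn (revBr T) (bridgeLists T L : Set (List HV)) := by
  intro l₁ h₁ l₂ h₂ h
  rw [mem_coe] at h₁ h₂
  have ha : lastX l₁ = lastX l₂ := by
    have e := congrArg List.getLast? h
    rw [getLast?_revBr hT h₁, getLast?_revBr hT h₂, Option.some_inj, Prod.mk.injEq] at e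
    exact e.1
  simp only [revBr, ha] at h
  exact List.reverse_inj.1 ((List.map_injective_iff.2 (sigmaT T (lastX l₂)).injective) h)

/-- `Σ` over the walks `a → β` of a function of the inner list = `Σ` over `bridgeLists`. [cite: DuminilCopinSmirnov2012, §3 (bridges)] -/
theorem sum_beta_eq_sum_bridgeLists (hT : 1 ≤ T) (g : List HV → ℝ) :
    ∑ P ∈ (midWalks (stripV T L)).filter (fun P => IsBetaDart T (finalDart P)), g (inner P)
      = ∑ l ∈ bridgeLists T L, g l := by
  rw [bridgeLists, sum_image]
  intro P hP P' hP' h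
  rw [mem_coe, mem_filter, mem_midWalks_iff] at hP hP'
  obtain ⟨l, hl, rfl, -⟩ := eq_of_isBetaDart hT hP.1 hP.2
  obtain ⟨l', hl', rfl, -⟩ := eq_of_isBetaDart hT hP'.1 hP'.2
  simp only [inner_cons_append] at h
  subst h; rfl

/-- `B_{T,L}(x; y)` as a sum over bridges. [cite: BeatonBousquetMelouDeGierDuminilCopinGuttmann2014, §3.1 (B_T(x, y), arXiv v5 p. 10)] -/
theorem stripGFxy_beta_eq (hT : 1 ≤ T) (x y : ℝ) :
    stripGFxy T L (IsBetaDart T) x y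
      = ∑ l ∈ bridgeLists T L, x ^ l.length * y ^ (l.filter fun v => lev v = 2 * (T : ℤ) - 1).length := by
  rw [stripGFxy, ← sum_beta_eq_sum_bridgeLists hT]
  refine sum_congr rfl fun P hP => ?_
  rw [mem_filter, mem_midWalks_iff] at hP
  rw [← hP.1.length_inner]; rfl

/-- The walks `a → β` of `S_{T,L}`, weighted by their LEVEL-0 vertices, are among the half-plane walks counted by `C^+_{T,L}`.
[cite: BeatonBousquetMelouDeGierDuminilCopinGuttmann2014, Prop. 5 (C^+(x, y), arXiv v5 p. 9)] -/
theorem sum_bridgeLists_bot_le_hpGF (hT : 1 ≤ T) {x y : ℝ} (hx : 0 ≤ x) (hy : 0 ≤ y) :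
    ∑ l ∈ bridgeLists T L, x ^ l.length * y ^ (l.filter fun v => lev v = 0).length ≤ hpGF T L x y := by
  rw [← sum_beta_eq_sum_bridgeLists hT (fun l => x ^ l.length * y ^ (l.filter fun v => lev v = 0).length), hpGF]
  calc ∑ P ∈ (midWalks (stripV T L)).filter (fun P => IsBetaDart T (finalDart P)),
        x ^ (inner P).length * y ^ ((inner P).filter fun v => lev v = 0).length
      = ∑ P ∈ (midWalks (stripV T L)).filter (fun P => IsBetaDart T (finalDart P)), x ^ mwLen P * y ^ botContacts P := by
        refine sum_congr rfl fun P hP => ?_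
        rw [mem_filter, mem_midWalks_iff] at hP
        rw [hP.1.length_inner]; rfl
    _ ≤ ∑ P ∈ midWalks (stripV T L), x ^ mwLen P * y ^ botContacts P :=
        sum_le_sum_of_subset_of_nonneg (filter_subset _ _) fun P _ _ => mul_nonneg (pow_nonneg hx _) (pow_nonneg hy _)

end Reversal

/-- **D6 `ReversalInjection` HOLDS**: `B_{T,L}(x; y) ≤ C^+_{T,2L+T}(x, y)` — reverse each bridge and apply the level flip `σ_{T,a}`.
[cite: BeatonBousquetMelouDeGierDuminilCopinGuttmann2014, Prop. 6 ("by the symmetry of bridges", arXiv v5 p. 10)] -/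
theorem reversalInjection_holds : ReversalInjection := by
  intro T L x y hT hx hy
  refine ⟨2 * L + T, ?_⟩
  rw [stripGFxy_beta_eq hT]
  calc ∑ l ∈ bridgeLists T L, x ^ l.length * y ^ (l.filter fun v => lev v = 2 * (T : ℤ) - 1).length
      = ∑ l ∈ bridgeLists T L, (fun l' : List HV => x ^ l'.length * y ^ (l'.filter fun v => lev v = 0).length) (revBr T l) := by
        refine sum_congr rfl fun l _ => ?_
        simp only [length_revBr, filter_revBr]
    _ ≤ ∑ l' ∈ bridgeLists T (2 * L + T), x ^ l'.length * y ^ (l'.filter fun v => lev v = 0).length :=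
        sum_le_sum_of_injOn_of_nonneg (revBr T) (revBr_injOn hT) (fun l hl => revBr_mem hT hl)
          (fun l' : List HV => x ^ l'.length * y ^ (l'.filter fun v => lev v = 0).length)
          fun l _ => mul_nonneg (pow_nonneg hx _) (pow_nonneg hy _)
    _ ≤ hpGF T (2 * L + T) x y := sum_bridgeLists_bot_le_hpGF hT hx hy

/-! ### D5 PROVED: one supercritical finite point of every strip (`μ(S_T) < μ_ℍ` in generating-function form) -/

section Supercrit

open Literature.Probability.LatticeModels Literature.Probability.Percolation

variable {T L : ℕ}

/-- The row chart `ℍ → brick wall` (tree `HexBW.hvToRow = rowIso.symm`) on vertex lists. [cite: EntingJensen2009, §7.4.2, Fig. 7.10 (brickwork form of the honeycomb lattice)] -/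
def toRowList (l : List HV) : List (Site 2) := l.map HexBW.hvToRow

/-- The strip pair of an `ℍ`-vertex list: (cross-section representative of its start, translate started at the origin) — the
DCS-frame twin of a-p5 g7's `toSlabPair`. [cite: MadrasSlade1993, §8.2, eq. (8.2.1)] -/
def toRowPair (l : List HV) : Site 2 × (ℕ → Site 2) :=
  (HexBW.snorm ((toRowList l).headD 0), fun s => HexBW.StripInsertion.ofList (toRowList l) s - (toRowList l).headD 0)

/-- The row chart is injective. [cite: EntingJensen2009, §7.4.2, Fig. 7.10] -/
theorem hvToRow_injective : Function.Injective HexBW.hvToRow := HexBW.rowEquiv.symm.injective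

/-- The row chart carries edges of `ℍ` to brick-wall bonds. [cite: EntingJensen2009, §7.4.2, Fig. 7.10] -/
theorem hvToRow_adj {u v : HV} (h : hvGraph.Adj u v) : brickWallGraph.Adj (HexBW.hvToRow u) (HexBW.hvToRow v) :=
  HexBW.rowIso.symm.map_rel_iff.2 h

/-- `toRowList` facts: non-empty, nodup, chain, head. [cite: MadrasSlade1993, §8.2] -/
theorem toRowList_spec {l : List HV} (hl : l ≠ []) (hc : l.IsChain hvGraph.Adj) (hnd : l.Nodup) :
    toRowList l ≠ [] ∧ (toRowList l).Nodup ∧ (toRowList l).IsChain brickWallGraph.Adj ∧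
      (toRowList l).head? = some ((toRowList l).headD 0) := by
  refine ⟨by simp [toRowList, hl], hnd.map hvToRow_injective, ?_, ?_⟩
  · rw [toRowList, List.isChain_map]
    exact hc.imp fun a b h => hvToRow_adj h
  · obtain ⟨a, l', rfl⟩ := List.exists_cons_of_ne_nil hl
    simp [toRowList]

/-- **A self-avoiding list of `ℍ` with levels in `[0, 2T+1]` is, after the row chart and re-basing, an element of
`HexBW.stripPairs T (|l| − 1)`** (the row strip `T` of the brick wall = the levels `0,…,2T+1`, tree `rowIso_symm_mem_strip_iff`).
[cite: MadrasSlade1993, §8.2, eq. (8.2.1); DuminilCopinSmirnov2012, §3 (the strips S_T)] -/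
theorem toRowPair_mem {T : ℕ} {l : List HV} (hl : l ≠ []) (hc : l.IsChain hvGraph.Adj) (hnd : l.Nodup)
    (hlev : ∀ w ∈ l, 0 ≤ lev w ∧ lev w ≤ 2 * (T : ℤ) + 1) :
    toRowPair l ∈ HexBW.stripPairs T (l.length - 1) := by
  obtain ⟨hne, hnd', hc', hh⟩ := toRowList_spec hl hc hnd
  set p := (toRowList l).headD 0 with hp
  have hlen : (toRowList l).length = l.length := List.length_map _
  obtain ⟨hsaws, hbw⟩ := HexBW.StripInsertion.ofList_sub_mem_saws hne hnd' hc' p hh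
  rw [hlen] at hsaws hbw
  have hrows : ∀ z ∈ toRowList l, HexBW.InStrip T z := by
    intro z hz
    rw [toRowList, List.mem_map] at hz
    obtain ⟨w, hw, rfl⟩ := hz
    exact (HexBW.rowIso_symm_mem_strip_iff T w).2 (hlev w hw)
  have hpmem : p ∈ toRowList l := List.mem_of_mem_head? hh
  have hpstrip : HexBW.InStrip T p := hrows p hpmem
  have heven := HexBW.snorm_shift_even p
  rw [toRowPair, HexBW.mem_stripPairs]
  refine ⟨HexBW.snorm_mem_stripStarts hpstrip, hsaws, ?_, ?_⟩
  · intro i hi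
    have key := hbw i hi
    have e : ∀ s, HexBW.snorm p + (HexBW.StripInsertion.ofList (toRowList l) s - p) =
        (HexBW.snorm p - p) + HexBW.StripInsertion.ofList (toRowList l) s := fun s => by abel
    dsimp only
    rw [e, e, HexBW.adj_add_left_iff_of_even]
    · exact key
    · have h2 := heven
      simp only [Pi.sub_apply] at h2 ⊢
      omega
  · intro m _
    have hmem := HexBW.StripInsertion.ofList_mem hne m
    have hin := hrows _ hmem
    have er : (HexBW.snorm p + (HexBW.StripInsertion.ofList (toRowList l) m - p)) 1 =
        (HexBW.StripInsertion.ofList (toRowList l) m) 1 := by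
      simp [HexBW.snorm_apply_one]
    unfold HexBW.InStrip at hin ⊢
    rw [er]
    exact hin

/-- The transfer is injective among lists with the same head and the same length. [cite: MadrasSlade1993, §8.2] -/
theorem toRowPair_inj {l l' : List HV} (hl : l ≠ []) (hl' : l' ≠ []) (hh : l.head? = l'.head?)
    (hlen : l.length = l'.length) (h : toRowPair l = toRowPair l') : l = l' := by
  have hmap : toRowList l = toRowList l' := by
    have hh' : (toRowList l).headD 0 = (toRowList l').headD 0 := by
      obtain ⟨a, m, rfl⟩ := List.exists_cons_of_ne_nil hl
      obtain ⟨a', m', rfl⟩ := List.exists_cons_of_ne_nil hl'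
      simp only [List.head?_cons, Option.some.injEq] at hh
      simp [toRowList, hh]
    have h2 := congrArg Prod.snd h
    simp only [toRowPair] at h2
    refine HexBW.StripInsertion.ofList_inj (by simp [toRowList, hlen]) fun s => ?_
    have := congrFun h2 s
    rw [hh'] at this
    exact sub_left_inj.1 this
  exact (List.map_injective_iff.2 hvToRow_injective) hmap

/-- **Bridges of `S_{T,L}` with `n + 1` vertices are at most `c_n(S_{T−1})` in number** (`T ≥ 1`; the DCS strip `S_T` = levels
`0,…,2T−1` = the brick-wall row strip `T − 1`). [cite: DuminilCopinSmirnov2012, §3 (S_T); MadrasSlade1993, §8.2, eq. (8.2.1)] -/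
theorem card_bridgeLists_filter_le (hT : 1 ≤ T) (n : ℕ) :
    ((bridgeLists T L).filter fun l => l.length = n + 1).card ≤ HexBW.stripCount (T - 1) n := by
  rw [HexBW.stripCount]
  refine Finset.card_le_card_of_injOn toRowPair (fun l hl => ?_) (fun l hl l' hl' h => ?_)
  · rw [Finset.mem_coe, Finset.mem_filter, mem_bridgeLists_iff hT] at hl
    obtain ⟨⟨hc, -, hnd, hV, hne, -⟩, hlen⟩ := hl
    have := toRowPair_mem (T := T - 1) hne hc hnd fun w hw => by
      have h := lev_mem_of_mem_stripV (hV w hw)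
      omega
    rw [hlen, Nat.add_sub_cancel] at this
    exact Finset.mem_coe.2 this
  · rw [Finset.mem_coe, Finset.mem_filter, mem_bridgeLists_iff hT] at hl hl'
    exact toRowPair_inj hl.1.2.2.2.2.1 hl'.1.2.2.2.2.1 (by rw [hl.1.2.1, hl'.1.2.1]) (by rw [hl.2, hl'.2]) h

/-- No bridge is empty: the fibre of length `0` is empty. [cite: DuminilCopinSmirnov2012, §3] -/
theorem card_bridgeLists_filter_zero (hT : 1 ≤ T) :
    ((bridgeLists T L).filter fun l => l.length = 0).card = 0 := by
  rw [Finset.card_eq_zero, Finset.filter_eq_empty_iff]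
  intro l hl h0
  rw [mem_bridgeLists_iff hT] at hl
  obtain ⟨-, -, -, -, hne, -⟩ := hl
  exact hne (List.eq_nil_of_length_eq_zero h0)

/-- The length fibres of the bridges are dominated by the strip counts, uniformly in `L`: `#{l : |l| = j} ≤ c_{j−1}(S_{T−1})`.
[cite: MadrasSlade1993, §8.2, eq. (8.2.1)] -/
theorem card_bridgeLists_fiber_le (hT : 1 ≤ T) (j : ℕ) :
    (((bridgeLists T L).filter fun l => l.length = j).card : ℝ) ≤ HexBW.stripCount (T - 1) (j - 1) := by
  rcases j with _ | n
  · rw [card_bridgeLists_filter_zero hT]; simp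
  · rw [Nat.add_sub_cancel]; exact_mod_cast card_bridgeLists_filter_le hT n

/-- `B_{T,L}(x; 1) = Σ_{bridges} x^{|l|}`, regrouped by length and dominated: `B_{T,L}(x; 1) ≤ Σ_{j} c_{j−1}(S_{T−1}) x^j` for any
summable majorant. [cite: BeatonBousquetMelouDeGierDuminilCopinGuttmann2014, Cor. 8 at y = 1 ("ρ_T(1) = 1/μ_{T−1}(1,1) > x_c", arXiv v5 p. 12)] -/
theorem stripGFxy_beta_one_le_tsum (hT : 1 ≤ T) {x : ℝ} (hx : 0 ≤ x)
    (hs : Summable fun j : ℕ => (HexBW.stripCount (T - 1) (j - 1) : ℝ) * x ^ j) :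
    stripGFxy T L (IsBetaDart T) x 1 ≤ ∑' j : ℕ, (HexBW.stripCount (T - 1) (j - 1) : ℝ) * x ^ j := by
  rw [stripGFxy_beta_eq hT]
  simp only [one_pow, mul_one]
  set s := bridgeLists T L
  have hmaps : ∀ l ∈ s, l.length ∈ s.image List.length := fun l hl => mem_image_of_mem _ hl
  calc ∑ l ∈ s, x ^ l.length
      = ∑ j ∈ s.image List.length, ∑ l ∈ s with l.length = j, x ^ l.length := (sum_fiberwise_of_maps_to hmaps _).symm
    _ = ∑ j ∈ s.image List.length, (((s.filter fun l => l.length = j).card : ℝ)) * x ^ j := by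
        refine sum_congr rfl fun j _ => ?_
        rw [sum_congr rfl fun l hl => by rw [(mem_filter.1 hl).2], sum_const, nsmul_eq_mul]
    _ ≤ ∑ j ∈ s.image List.length, (HexBW.stripCount (T - 1) (j - 1) : ℝ) * x ^ j :=
        sum_le_sum fun j _ => mul_le_mul_of_nonneg_right (card_bridgeLists_fiber_le hT j) (pow_nonneg hx _)
    _ ≤ ∑' j : ℕ, (HexBW.stripCount (T - 1) (j - 1) : ℝ) * x ^ j :=
        hs.sum_le_tsum _ fun j _ => mul_nonneg (Nat.cast_nonneg _) (pow_nonneg hx _)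

/-- **Supercritical summability of the narrower strip**: for `T ≥ 1` there is `x₁ > x_c` with `Σ_n c_n(S_{T−1}) x₁^n < ∞`, because
`c_n(S_{T−1})^{1/n} → μ(S_{T−1}) < μ_ℍ = 1/x_c` (tree `HexBW.stripConnectiveConstant_lt_hex`, `HexBW.tendsto_stripCount_rpow`,
`hexConnectiveConstant_eq_inv`). [cite: BeatonBousquetMelouDeGierDuminilCopinGuttmann2014, Prop. 7 at y = 1 (μ_T < μ, arXiv v5 pp. 11–12); MadrasSlade1993, §8.2 (8.2.11)] -/
theorem exists_supercrit_summable (T' : ℕ) :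
    ∃ x₁ : ℝ, hexCriticalFugacity < x₁ ∧ 0 < x₁ ∧ Summable fun n : ℕ => (HexBW.stripCount T' n : ℝ) * x₁ ^ n := by
  obtain ⟨hx0, -⟩ := hexCriticalFugacity_pos_lt_one
  set μS := HexBW.stripConnectiveConstant T' with hμS
  have hμS0 : 0 < μS := HexBW.stripConnectiveConstant_pos _
  have hlt : μS < hexCriticalFugacity⁻¹ := by
    rw [← hexConnectiveConstant_eq_inv]; exact HexBW.stripConnectiveConstant_lt_hex _
  set ρ := (μS + hexCriticalFugacity⁻¹) / 2 with hρ
  have hμρ : μS < ρ := by rw [hρ]; linarith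
  have hρlt : ρ < hexCriticalFugacity⁻¹ := by rw [hρ]; linarith
  have hρ0 : 0 < ρ := by linarith
  set ν := (μS + ρ) / 2 with hν
  have hμν : μS < ν := by rw [hν]; linarith
  have hνρ : ν < ρ := by rw [hν]; linarith
  have hν0 : 0 < ν := by linarith
  refine ⟨ρ⁻¹, (lt_inv_comm₀ hx0 hρ0).2 hρlt, inv_pos.2 hρ0, ?_⟩
  have hq : ν * ρ⁻¹ < 1 := by rw [mul_inv_lt_iff₀ hρ0, one_mul]; exact hνρ
  have hq0 : 0 ≤ ν * ρ⁻¹ := by positivity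
  have hev : ∀ᶠ m : ℕ in atTop, (HexBW.stripCount T' m : ℝ) * ρ⁻¹ ^ m ≤ (ν * ρ⁻¹) ^ m := by
    have h1 := (HexBW.tendsto_stripCount_rpow T').eventually (gt_mem_nhds hμν)
    filter_upwards [h1, eventually_ge_atTop 1] with m hm hm1
    have hc0 : (0 : ℝ) ≤ HexBW.stripCount T' m := Nat.cast_nonneg _
    have hpow : (HexBW.stripCount T' m : ℝ) ≤ ν ^ m := by
      have h2 : ((HexBW.stripCount T' m : ℝ) ^ (1 / (m : ℝ))) ^ (m : ℝ) ≤ ν ^ (m : ℝ) :=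
        Real.rpow_le_rpow (Real.rpow_nonneg hc0 _) hm.le (Nat.cast_nonneg m)
      rw [← Real.rpow_mul hc0, one_div_mul_cancel (by positivity), Real.rpow_one, Real.rpow_natCast] at h2
      exact h2
    rw [mul_pow]
    exact mul_le_mul_of_nonneg_right hpow (pow_nonneg (inv_pos.2 hρ0).le m)
  refine Summable.of_norm_bounded_eventually_nat (summable_geometric_of_lt_one hq0 hq) ?_
  filter_upwards [hev] with m hm
  rw [Real.norm_of_nonneg (by positivity)]
  exact hm

end Supercrit

/-- **D5 `StripSupercritFinite` HOLDS**: for every `T ≥ 1` some `x₁ > x_c` keeps `L ↦ B_{T,L}(x₁; 1)` bounded — the honeycomb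
HEX-STRIP-STRICT `μ(S_{T−1}) < μ_ℍ` of the tree, in generating-function form.
[cite: BeatonBousquetMelouDeGierDuminilCopinGuttmann2014, Prop. 7 and Cor. 8 at y = 1 (arXiv v5 pp. 11–12)] -/
theorem stripSupercritFinite_holds : StripSupercritFinite := by
  intro T hT
  obtain ⟨x₁, hx₁c, hx₁0, hs⟩ := exists_supercrit_summable (T - 1)
  have hs' : Summable fun j : ℕ => (HexBW.stripCount (T - 1) (j - 1) : ℝ) * x₁ ^ j := by
    rw [← summable_nat_add_iff 1]
    have : (fun n : ℕ => (HexBW.stripCount (T - 1) (n + 1 - 1) : ℝ) * x₁ ^ (n + 1))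
        = fun n : ℕ => ((HexBW.stripCount (T - 1) n : ℝ) * x₁ ^ n) * x₁ := by
      funext n; rw [Nat.add_sub_cancel, pow_succ, mul_assoc]
    rw [this]
    exact hs.mul_right x₁
  exact ⟨x₁, hx₁c, ⟨_, by rintro _ ⟨L, rfl⟩; exact stripGFxy_beta_one_le_tsum hT hx₁0.le hs'⟩⟩

end Literature.Probability.RandomPlanarGeometry.SAW.HV
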